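import Literature.NumberTheory.Rogawski1990.ArchHCOrbitalFamilyG                 -- PART 2 (LH3-p02): generic `toReal_measure_mul_integral_quotientMeasure_eq_of_isHaarMeasure` (Haar-freeness), `orbFamG`, the G′ junction
import Literature.NumberTheory.Rogawski1990.ArchCompatibleFamiliesScalar             -- ★ p849637 (LH3-p02): `atPoint_eq_quotientMeasure_tH_of_isArchGRegular`, `isArchGRegular_conj`, `map_tH_eq_t'_partner`
import Literature.NumberTheory.Automorphic.ArchEndoscopicChartTorusRange             -- ★ B1 (LH2-p04): `mem_chartTorusH_iff` (+ ★ (T-MEAS) `chartTorusH ∕ chartBoxImg ∕ chartHaarH ∕ chartOrbH`)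
import Literature.NumberTheory.Automorphic.ArchEndoscopicCartanAtlasCentralizer      -- ★ (CENT-H) (LH3-p03): `mem_centralizer_endoTorus_iff`
import HarnessLib

/-!
# The (CUR-chart) junction on the `H` side: the frame's class orbital integral at a chart point of `H_∞` × the frame's torus mass of the chart box = `chartOrbH`
# (Rogawski 1990 §1.7, §4.3 (4.3.1), §8.2; Shelstad 1979 §4 p. 20–22; Deitmar–Echterhoff 2014 Thm. 1.5.3)

Topic `NumberTheory/Rogawski1990`; namespace `Literature.NumberTheory.Rogawski1990`.  THEOREMS ONLY (no definition, no instance, no notation, no axiom, no named fact, no `sorry`).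
Cell `pub/hodgecm-mathlib`, crux H413 (`stmt-HodgeConjecture-24833`), F0∕P3c line LH3 (closer stub `stub_N9`, DIRECT ROAD): PART 2b of (CUR-chart) (LH3-plan (g2) PACK-SPEC v1
§1 «junction to the frame»), LH3-p02 (g2); the `H`-side twin of ★ `classOrbitalIntegral_mul_measure_box_eq_chartOrbG` (PART 2).

* §1 `chartTorusH_eq_centralizer_of_mem_regS` — at `c ∈ RegS S` the chart torus ★ `chartTorusH L S` IS `Z_{H_∞}(endoTorus S c)` (★ B1 `mem_chartTorusH_iff` + ★ (CENT-H)
  `mem_centralizer_endoTorus_iff`; the presentation the junction reads through).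
* §2 **`classOrbitalIntegral_mul_measure_box_eq_chartOrbH`** — for a frame in print's measure convention on `H_∞` relative to `G_∞` ((W_H)+(C_H) of ★ `ArchCompatibleFamiliesH` and
  (C) of ★ `ArchCompatibleFamiliesG`, clause binders as in ★ p849637 §2) and a `G`-REGULAR chart point `γ_H = endoTorus S c` (`c ∈ RegS S`):
  `Φ(⟦γ_H⟧, f_H; m_H) · (t_H(γ_H) carried to T_S)(B_S) = chartOrbH ν_H S f_H c` — ★ p849637 `atPoint_eq_quotientMeasure_tH_of_isArchGRegular` (the frame reads `dν_H ∕ dt_H(γ_H)` ON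
  THE NOSE at `G`-regular points) + ★ (D3) over the presentation `T_S = Z(γ_H)` + Haar-freeness (PART 2 §1).  The scalar is the `t_H(γ_H)`-mass of the chart box — by ★
  `map_tH_eq_t'_partner` the same number as the partner's `t′(γ′)`-mass of the transported box: §3.
* §3 **`measure_box_partner_eq_of_image_eq`** — the PACKET COROLLARY in measure form: in one compatible frame, for a partner `γ′` of a `G`-regular `γ_H` and ANY measurable sets
  `B ⊆ Z(γ_H)`, `B′ ⊆ Z(γ′)` with `(e ∘ ι) '' B = B′` (the (PARTNER) coordinate correspondence, LH3-p03 — a HYPOTHESIS here), `t′(γ′)(B′) = t_H(γ_H)(B)`: the two junction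
  scalars COINCIDE, so `(H-side chart reading) ∕ (G′-side chart reading)`-identities are frame identities with NO free scalar left (MEMO v2-delta §C3).
HONEST LABEL: HC_CM is proved only modulo the 7 printed citations (2 remaining: hLiu418 = `stmt-HodgeConjecture-24832`, h413 = `stmt-HodgeConjecture-24833`) until rung 0 closes;
count-neutral plumbing for the skeleton's (READ) step.

## References
* [Rogawski1990] J. D. Rogawski, *Automorphic Representations of Unitary Groups in Three Variables*, Ann. of Math. Stud. 123 (1990), §1.7 p. 6, §4.3 (4.3.1) p. 43, §8.2 p. 122, §14.3 pp. 233–234.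
* [Shelstad1979] D. Shelstad, *Characters and inner forms of a quasi-split group over ℝ*, Compositio Math. 39 (1979), §4 p. 20 (compatible `dt′, dt`), p. 22 (`Φ^T_f`).
* [LanglandsShelstad1987] R. P. Langlands, D. Shelstad, *On the definition of transfer factors*, Math. Ann. 278 (1987), §1.3–1.4.
* [DeitmarEchterhoff2014] A. Deitmar, S. Echterhoff, *Principles of Harmonic Analysis*, 2nd ed. (2014), Thm. 1.5.3.
-/

set_option autoImplicit false

noncomputable section

open MeasureTheory MeasureTheory.Measure NumberField NumberField.InfinitePlace Matrix Complex Topology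
open Literature.MeasureTheory.Group
open scoped MatrixGroups Matrix Classical NNReal ENNReal

namespace Literature.NumberTheory.Rogawski1990

open Literature.NumberTheory.Automorphic Literature.NumberTheory.Automorphic.UnitaryGroup Literature.NumberTheory.Automorphic.ArchCartan

/-! ## §1 The presentation: at an `H`-regular chart point the chart torus is the centraliser -/

section Presentation

variable (L : Type) [Field L] [NumberField L] [IsCMField L] (S : Finset {w : InfinitePlace L // IsComplex w})

/-- **`T_S = Z_{H_∞}(endoTorus S c)` at `c ∈ RegS S`** (★ B1 `mem_chartTorusH_iff`: `T_S` is exactly the chart points; ★ (CENT-H) `mem_centralizer_endoTorus_iff`: so is the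
centraliser of an `H`-regular chart point). [cite: Rogawski1990, §3.6 p. 31] [cite: Shelstad1979, §4 p. 22] -/
theorem chartTorusH_eq_centralizer_of_mem_regS {c : {w : InfinitePlace L // IsComplex w} → Fin 3 → ℝ} (hc : c ∈ ArchCartan.RegS S) :
    chartTorusH L S = Subgroup.centralizer ({endoTorus L S c} : Set (↥(arch (↥(maximalRealSubfield L)) L (IsCMField.complexConj L) 2 (Matrix.of fun i j : Fin 2 => if i.val + j.val + 1 = 2 then (1 : L) else 0)) × ↥(arch (↥(maximalRealSubfield L)) L (IsCMField.complexConj L) 1 (Matrix.of fun i j : Fin 1 => if i.val + j.val + 1 = 1 then (1 : L) else 0)))) := by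
  ext h
  rw [mem_chartTorusH_iff, mem_centralizer_endoTorus_iff L S hc]
  constructor
  · rintro ⟨c', hc'⟩; exact ⟨c', hc'.symm⟩
  · rintro ⟨c', hc'⟩; exact ⟨c', hc'.symm⟩

end Presentation

/-! ## §2 The `H`-side junction -/

section JunctionH

variable (L : Type) [Field L] [NumberField L] [IsCMField L]
  [MeasurableSpace ↥(arch (↥(maximalRealSubfield L)) L (IsCMField.complexConj L) 3 (Matrix.of fun i j : Fin 3 => if i.val + j.val + 1 = 3 then (1 : L) else 0))] [BorelSpace ↥(arch (↥(maximalRealSubfield L)) L (IsCMField.complexConj L) 3 (Matrix.of fun i j : Fin 3 => if i.val + j.val + 1 = 3 then (1 : L) else 0))]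
  [MeasurableSpace (↥(arch (↥(maximalRealSubfield L)) L (IsCMField.complexConj L) 2 (Matrix.of fun i j : Fin 2 => if i.val + j.val + 1 = 2 then (1 : L) else 0)) × ↥(arch (↥(maximalRealSubfield L)) L (IsCMField.complexConj L) 1 (Matrix.of fun i j : Fin 1 => if i.val + j.val + 1 = 1 then (1 : L) else 0)))] [BorelSpace (↥(arch (↥(maximalRealSubfield L)) L (IsCMField.complexConj L) 2 (Matrix.of fun i j : Fin 2 => if i.val + j.val + 1 = 2 then (1 : L) else 0)) × ↥(arch (↥(maximalRealSubfield L)) L (IsCMField.complexConj L) 1 (Matrix.of fun i j : Fin 1 => if i.val + j.val + 1 = 1 then (1 : L) else 0)))]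
  (t : ∀ γ : ↥(arch (↥(maximalRealSubfield L)) L (IsCMField.complexConj L) 3 (Matrix.of fun i j : Fin 3 => if i.val + j.val + 1 = 3 then (1 : L) else 0)), Measure (Subgroup.centralizer ({γ} : Set ↥(arch (↥(maximalRealSubfield L)) L (IsCMField.complexConj L) 3 (Matrix.of fun i j : Fin 3 => if i.val + j.val + 1 = 3 then (1 : L) else 0)))))
  (tH : ∀ γH : (↥(arch (↥(maximalRealSubfield L)) L (IsCMField.complexConj L) 2 (Matrix.of fun i j : Fin 2 => if i.val + j.val + 1 = 2 then (1 : L) else 0)) × ↥(arch (↥(maximalRealSubfield L)) L (IsCMField.complexConj L) 1 (Matrix.of fun i j : Fin 1 => if i.val + j.val + 1 = 1 then (1 : L) else 0))), Measure (Subgroup.centralizer ({γH} : Set (↥(arch (↥(maximalRealSubfield L)) L (IsCMField.complexConj L) 2 (Matrix.of fun i j : Fin 2 => if i.val + j.val + 1 = 2 then (1 : L) else 0)) × ↥(arch (↥(maximalRealSubfield L)) L (IsCMField.complexConj L) 1 (Matrix.of fun i j : Fin 1 => if i.val + j.val + 1 = 1 then (1 : L) else 0))))))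
  (hd₃ : ((Matrix.of fun i j : Fin 3 => if i.val + j.val + 1 = 3 then (1 : L) else 0) : Matrix (Fin 3) (Fin 3) L).det ≠ 0)
  -- (C) of ★ `ArchCompatibleFamiliesG`
  (hC : ∀ (γ₁ γ₂ : ↥(arch (↥(maximalRealSubfield L)) L (IsCMField.complexConj L) 3 (Matrix.of fun i j : Fin 3 => if i.val + j.val + 1 = 3 then (1 : L) else 0))) (h₁ : IsRegularElt (γ₁.val : GL (Fin 3) (mixedEmbedding.mixedSpace L)))
      (hc : Corresponds (UnitaryGroup.conjMixed (↥(maximalRealSubfield L)) L (IsCMField.complexConj L))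
        (UnitaryGroup.archFormOf L 3 (Matrix.of fun i j : Fin 3 => if i.val + j.val + 1 = 3 then (1 : L) else 0))
        (UnitaryGroup.archFormOf L 3 (Matrix.of fun i j : Fin 3 => if i.val + j.val + 1 = 3 then (1 : L) else 0)) γ₁ γ₂),
      Measure.map ⇑(UnitaryGroup.archStableCentralizerEquiv L hd₃ hd₃ hc h₁) (t γ₁) = t γ₂)
  -- (C_H) of ★ `ArchCompatibleFamiliesH`
  (hCH : ∀ γH : (↥(arch (↥(maximalRealSubfield L)) L (IsCMField.complexConj L) 2 (Matrix.of fun i j : Fin 2 => if i.val + j.val + 1 = 2 then (1 : L) else 0)) × ↥(arch (↥(maximalRealSubfield L)) L (IsCMField.complexConj L) 1 (Matrix.of fun i j : Fin 1 => if i.val + j.val + 1 = 1 then (1 : L) else 0))), IsArchGRegular L γH → Measure.map ⇑(endoEmbArchCentralizer L γH) (tH γH) = t (endoEmbArch L γH))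
  -- orbit-quotient σ-algebras on `H_∞` (binders; `borel` in the letter's frame)
  [qHH : ∀ a : (↥(arch (↥(maximalRealSubfield L)) L (IsCMField.complexConj L) 2 (Matrix.of fun i j : Fin 2 => if i.val + j.val + 1 = 2 then (1 : L) else 0)) × ↥(arch (↥(maximalRealSubfield L)) L (IsCMField.complexConj L) 1 (Matrix.of fun i j : Fin 1 => if i.val + j.val + 1 = 1 then (1 : L) else 0))), MeasurableSpace ((↥(arch (↥(maximalRealSubfield L)) L (IsCMField.complexConj L) 2 (Matrix.of fun i j : Fin 2 => if i.val + j.val + 1 = 2 then (1 : L) else 0)) × ↥(arch (↥(maximalRealSubfield L)) L (IsCMField.complexConj L) 1 (Matrix.of fun i j : Fin 1 => if i.val + j.val + 1 = 1 then (1 : L) else 0))) ⧸ Subgroup.centralizer ({a} : Set (↥(arch (↥(maximalRealSubfield L)) L (IsCMField.complexConj L) 2 (Matrix.of fun i j : Fin 2 => if i.val + j.val + 1 = 2 then (1 : L) else 0)) × ↥(arch (↥(maximalRealSubfield L)) L (IsCMField.complexConj L) 1 (Matrix.of fun i j : Fin 1 => if i.val + j.val + 1 = 1 then (1 : L) else 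0)))))]
  [qbHH : ∀ a : (↥(arch (↥(maximalRealSubfield L)) L (IsCMField.complexConj L) 2 (Matrix.of fun i j : Fin 2 => if i.val + j.val + 1 = 2 then (1 : L) else 0)) × ↥(arch (↥(maximalRealSubfield L)) L (IsCMField.complexConj L) 1 (Matrix.of fun i j : Fin 1 => if i.val + j.val + 1 = 1 then (1 : L) else 0))), BorelSpace ((↥(arch (↥(maximalRealSubfield L)) L (IsCMField.complexConj L) 2 (Matrix.of fun i j : Fin 2 => if i.val + j.val + 1 = 2 then (1 : L) else 0)) × ↥(arch (↥(maximalRealSubfield L)) L (IsCMField.complexConj L) 1 (Matrix.of fun i j : Fin 1 => if i.val + j.val + 1 = 1 then (1 : L) else 0))) ⧸ Subgroup.centralizer ({a} : Set (↥(arch (↥(maximalRealSubfield L)) L (IsCMField.complexConj L) 2 (Matrix.of fun i j : Fin 2 => if i.val + j.val + 1 = 2 then (1 : L) else 0)) × ↥(arch (↥(maximalRealSubfield L)) L (IsCMField.complexConj L) 1 (Matrix.of fun i j : Fin 1 => if i.val + j.val + 1 = 1 then (1 : L) else 0)))))]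
  (νH : Measure (↥(arch (↥(maximalRealSubfield L)) L (IsCMField.complexConj L) 2 (Matrix.of fun i j : Fin 2 => if i.val + j.val + 1 = 2 then (1 : L) else 0)) × ↥(arch (↥(maximalRealSubfield L)) L (IsCMField.complexConj L) 1 (Matrix.of fun i j : Fin 1 => if i.val + j.val + 1 = 1 then (1 : L) else 0)))) [νH.IsHaarMeasure] [νH.IsMulRightInvariant]
  (mH : OrbitalMeasureFamily (↥(arch (↥(maximalRealSubfield L)) L (IsCMField.complexConj L) 2 (Matrix.of fun i j : Fin 2 => if i.val + j.val + 1 = 2 then (1 : L) else 0)) × ↥(arch (↥(maximalRealSubfield L)) L (IsCMField.complexConj L) 1 (Matrix.of fun i j : Fin 1 => if i.val + j.val + 1 = 1 then (1 : L) else 0))))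
  -- (W_H) of ★ `ArchCompatibleFamiliesH`
  (hWH : mH.IsQuotientOf (IsArchGRegular L) νH tH)

include hC hCH hWH in
/-- **THE (CUR-chart) JUNCTION ON `H`: FRAME READING × FRAME MASS OF THE BOX = CHART READING.**  For a frame in print's measure convention on `H_∞` relative to `G_∞` ((W_H)+(C_H),
(C)) and a `G`-regular chart point `γ_H = endoTorus S c`, `c ∈ RegS S` (presentation `hT : T_S = Z(γ_H)`, e.g. `chartTorusH_eq_centralizer_of_mem_regS`):
`Φ(⟦γ_H⟧, f_H; m_H) · (t_H(γ_H) carried to T_S)(B_S) = chartOrbH ν_H S f_H c`.  Road: ★ p849637 `atPoint_eq_quotientMeasure_tH_of_isArchGRegular` + ★ (D3)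
`exists_classOrbitalIntegral_mk_eq_integral_descConj_smul_of_atPoint_eq` over `T_S` against the auxiliary ★ `chartHaarH` + Haar-freeness (PART 2 §1).
[cite: Rogawski1990, §1.7 p. 6; §4.3 (4.3.1) p. 43; §8.2 p. 122] [cite: Shelstad1979, §4 pp. 20–22] [cite: DeitmarEchterhoff2014, Thm. 1.5.3] -/
theorem classOrbitalIntegral_mul_measure_box_eq_chartOrbH (S : Finset {w : InfinitePlace L // IsComplex w}) {c : {w : InfinitePlace L // IsComplex w} → Fin 3 → ℝ}
    (hT : chartTorusH L S = Subgroup.centralizer ({endoTorus L S c} : Set (↥(arch (↥(maximalRealSubfield L)) L (IsCMField.complexConj L) 2 (Matrix.of fun i j : Fin 2 => if i.val + j.val + 1 = 2 then (1 : L) else 0)) × ↥(arch (↥(maximalRealSubfield L)) L (IsCMField.complexConj L) 1 (Matrix.of fun i j : Fin 1 => if i.val + j.val + 1 = 1 then (1 : L) else 0))))) (hreg : IsArchGRegular L (endoTorus L S c)) (fH : (↥(arch (↥(maximalRealSubfield L)) L (IsCMField.complexConj L) 2 (Matrix.of fun i j : Fin 2 => if i.val + j.val + 1 = 2 then (1 :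 L) else 0)) × ↥(arch (↥(maximalRealSubfield L)) L (IsCMField.complexConj L) 1 (Matrix.of fun i j : Fin 1 => if i.val + j.val + 1 = 1 then (1 : L) else 0))) → ℂ) :
    classOrbitalIntegral mH fH (ConjClasses.mk (endoTorus L S c)) *
        (((tH (endoTorus L S c)).map ⇑(MulEquiv.subgroupCongr hT).symm (chartBoxImg L S)).toReal : ℂ) =
      chartOrbH L νH S fH c := by
  letI : MeasurableSpace ((↥(arch (↥(maximalRealSubfield L)) L (IsCMField.complexConj L) 2 (Matrix.of fun i j : Fin 2 => if i.val + j.val + 1 = 2 then (1 : L) else 0)) × ↥(arch (↥(maximalRealSubfield L)) L (IsCMField.complexConj L) 1 (Matrix.of fun i j : Fin 1 => if i.val + j.val + 1 = 1 then (1 : L) else 0))) ⧸ chartTorusH L S) := borel _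
  haveI : BorelSpace ((↥(arch (↥(maximalRealSubfield L)) L (IsCMField.complexConj L) 2 (Matrix.of fun i j : Fin 2 => if i.val + j.val + 1 = 2 then (1 : L) else 0)) × ↥(arch (↥(maximalRealSubfield L)) L (IsCMField.complexConj L) 1 (Matrix.of fun i j : Fin 1 => if i.val + j.val + 1 = 1 then (1 : L) else 0))) ⧸ chartTorusH L S) := ⟨rfl⟩
  haveI := isHaarMeasure_chartHaarH L S
  haveI := isInvInvariant_chartHaarH L S
  -- (W_H)+(C_H)+(C) read AT the `G`-regular point: `m_H.atPoint γ_H = dν_H ∕ dt_H(γ_H)`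
  obtain ⟨i1, i2, hq⟩ := atPoint_eq_quotientMeasure_tH_of_isArchGRegular L t tH hd₃ hC hCH νH mH hWH (endoTorus L S c) hreg
  haveI := i1
  haveI := i2
  have hout : IsArchGRegular L (Quotient.out (ConjClasses.mk (endoTorus L S c))) := by
    rw [out_conjClassesMk_eq_conj]
    exact isArchGRegular_conj L _ _ hreg
  haveI := hWH.isAdmissibleOn.smulInvariantMeasure (c := ConjClasses.mk (endoTorus L S c)) hout
  -- (D3) over the presentation `T_S = Z(γ_H)` against the auxiliary Haar `dt_S`
  obtain ⟨κ, hκ, i3, i4, hρ, hI⟩ := (mH.exists_classOrbitalIntegral_mk_eq_integral_descConj_smul_of_atPoint_eq (endoTorus L S c) hq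
    hT (forall_mem_chartTorusH_comm L S c) (isClosed_chartTorusH L S) (chartHaarH L S) fH)
  haveI := i3
  haveI := i4
  -- `t_H(γ_H)` carried to `T_S` is `κ • dt_S`
  have hmeas : Measurable ⇑(MulEquiv.subgroupCongr hT) := (continuous_subtype_val.subtype_mk _ : Continuous ⇑(MulEquiv.subgroupCongr hT)).measurable
  have hmeas' : Measurable ⇑(MulEquiv.subgroupCongr hT).symm := (continuous_subtype_val.subtype_mk _ : Continuous ⇑(MulEquiv.subgroupCongr hT).symm).measurable
  have hcarry : (tH (endoTorus L S c)).map ⇑(MulEquiv.subgroupCongr hT).symm = κ • chartHaarH L S := by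
    rw [hρ, Measure.map_map hmeas' hmeas]
    have hid : (⇑(MulEquiv.subgroupCongr hT).symm ∘ ⇑(MulEquiv.subgroupCongr hT)) = id := funext fun x => (MulEquiv.subgroupCongr hT).symm_apply_apply x
    rw [hid, Measure.map_id]
  -- Haar-freeness of the box-normalised chart functional against `κ • dt_S`, then (D3)
  have hfree : chartOrbH L νH S fH c = (((κ • chartHaarH L S) (chartBoxImg L S)).toReal : ℂ) *
      ∫ y, descConj (endoTorus L S c) (chartTorusH L S) (forall_mem_chartTorusH_comm L S c) fH y
        ∂(quotientMeasure (chartTorusH L S) (κ • chartHaarH L S) (isClosed_chartTorusH L S) νH) := by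
    rw [chartOrbH_def]
    exact Literature.MeasureTheory.Group.toReal_measure_mul_integral_quotientMeasure_eq_of_isHaarMeasure (chartTorusH L S) (isClosed_chartTorusH L S) νH
      (chartHaarH L S) (κ • chartHaarH L S) (chartBoxImg L S) _
  rw [hcarry, hfree, hI, mul_comm]

end JunctionH

/-! ## §3 The packet corollary in measure form: partner boxes have the same frame mass -/

section Packet

variable (L : Type) [Field L] [NumberField L] [IsCMField L] (H' : Matrix (Fin 3) (Fin 3) L)
  [MeasurableSpace (↥(arch (↥(maximalRealSubfield L)) L (IsCMField.complexConj L) 3 H'))] [BorelSpace (↥(arch (↥(maximalRealSubfield L)) L (IsCMField.complexConj L) 3 H'))]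
  [MeasurableSpace ↥(arch (↥(maximalRealSubfield L)) L (IsCMField.complexConj L) 3 (Matrix.of fun i j : Fin 3 => if i.val + j.val + 1 = 3 then (1 : L) else 0))] [BorelSpace ↥(arch (↥(maximalRealSubfield L)) L (IsCMField.complexConj L) 3 (Matrix.of fun i j : Fin 3 => if i.val + j.val + 1 = 3 then (1 : L) else 0))]
  [MeasurableSpace (↥(arch (↥(maximalRealSubfield L)) L (IsCMField.complexConj L) 2 (Matrix.of fun i j : Fin 2 => if i.val + j.val + 1 = 2 then (1 : L) else 0)) × ↥(arch (↥(maximalRealSubfield L)) L (IsCMField.complexConj L) 1 (Matrix.of fun i j : Fin 1 => if i.val + j.val + 1 = 1 then (1 : L) else 0)))] [BorelSpace (↥(arch (↥(maximalRealSubfield L)) L (IsCMField.complexConj L) 2 (Matrix.of fun i j : Fin 2 => if i.val + j.val + 1 = 2 then (1 : L) else 0)) × ↥(arch (↥(maximalRealSubfield L)) L (IsCMField.complexConj L) 1 (Matrix.of fun i j : Fin 1 => if i.val + j.val + 1 = 1 then (1 : L) else 0)))]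
  (t' : ∀ γ' : ↥(arch (↥(maximalRealSubfield L)) L (IsCMField.complexConj L) 3 H'), Measure (Subgroup.centralizer ({γ'} : Set (↥(arch (↥(maximalRealSubfield L)) L (IsCMField.complexConj L) 3 H')))))
  (t : ∀ γ : ↥(arch (↥(maximalRealSubfield L)) L (IsCMField.complexConj L) 3 (Matrix.of fun i j : Fin 3 => if i.val + j.val + 1 = 3 then (1 : L) else 0)), Measure (Subgroup.centralizer ({γ} : Set ↥(arch (↥(maximalRealSubfield L)) L (IsCMField.complexConj L) 3 (Matrix.of fun i j : Fin 3 => if i.val + j.val + 1 = 3 then (1 : L) else 0)))))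
  (tH : ∀ γH : (↥(arch (↥(maximalRealSubfield L)) L (IsCMField.complexConj L) 2 (Matrix.of fun i j : Fin 2 => if i.val + j.val + 1 = 2 then (1 : L) else 0)) × ↥(arch (↥(maximalRealSubfield L)) L (IsCMField.complexConj L) 1 (Matrix.of fun i j : Fin 1 => if i.val + j.val + 1 = 1 then (1 : L) else 0))), Measure (Subgroup.centralizer ({γH} : Set (↥(arch (↥(maximalRealSubfield L)) L (IsCMField.complexConj L) 2 (Matrix.of fun i j : Fin 2 => if i.val + j.val + 1 = 2 then (1 : L) else 0)) × ↥(arch (↥(maximalRealSubfield L)) L (IsCMField.complexConj L) 1 (Matrix.of fun i j : Fin 1 => if i.val + j.val + 1 = 1 then (1 : L) else 0))))))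
  (hd' : H'.det ≠ 0) (hd₃ : ((Matrix.of fun i j : Fin 3 => if i.val + j.val + 1 = 3 then (1 : L) else 0) : Matrix (Fin 3) (Fin 3) L).det ≠ 0)
  (hC'G : ∀ (γ' : ↥(arch (↥(maximalRealSubfield L)) L (IsCMField.complexConj L) 3 H')) (γ : ↥(arch (↥(maximalRealSubfield L)) L (IsCMField.complexConj L) 3 (Matrix.of fun i j : Fin 3 => if i.val + j.val + 1 = 3 then (1 : L) else 0))) (h' : IsRegularElt (γ'.val : GL (Fin 3) (mixedEmbedding.mixedSpace L)))
      (hc : Corresponds (UnitaryGroup.conjMixed (↥(maximalRealSubfield L)) L (IsCMField.complexConj L))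
        (UnitaryGroup.archFormOf L 3 H') (UnitaryGroup.archFormOf L 3 (Matrix.of fun i j : Fin 3 => if i.val + j.val + 1 = 3 then (1 : L) else 0)) γ' γ),
      Measure.map ⇑(UnitaryGroup.archStableCentralizerEquiv L hd' hd₃ hc h') (t' γ') = t γ)
  (hCH : ∀ γH : (↥(arch (↥(maximalRealSubfield L)) L (IsCMField.complexConj L) 2 (Matrix.of fun i j : Fin 2 => if i.val + j.val + 1 = 2 then (1 : L) else 0)) × ↥(arch (↥(maximalRealSubfield L)) L (IsCMField.complexConj L) 1 (Matrix.of fun i j : Fin 1 => if i.val + j.val + 1 = 1 then (1 : L) else 0))), IsArchGRegular L γH → Measure.map ⇑(endoEmbArchCentralizer L γH) (tH γH) = t (endoEmbArch L γH))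
  {γH : (↥(arch (↥(maximalRealSubfield L)) L (IsCMField.complexConj L) 2 (Matrix.of fun i j : Fin 2 => if i.val + j.val + 1 = 2 then (1 : L) else 0)) × ↥(arch (↥(maximalRealSubfield L)) L (IsCMField.complexConj L) 1 (Matrix.of fun i j : Fin 1 => if i.val + j.val + 1 = 1 then (1 : L) else 0)))} (hreg : IsArchGRegular L γH)

include hC'G hCH in
/-- **PARTNER BOXES HAVE THE SAME FRAME MASS.**  In one frame with (C_H)+(C′G), for a `G`-regular `γ_H`, a partner `γ′` (`ι_∞ γ_H ↔ γ′`) and measurable sets `B ⊆ Z(γ_H)`,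
`B′ ⊆ Z(γ′)` that CORRESPOND under the canonical torus map `e ∘ ι` (`(e ∘ ι) '' B = B′` — the (PARTNER) lemma's coordinate statement, a hypothesis here): `t′(γ′)(B′) = t_H(γ_H)(B)`
(★ `map_tH_eq_t'_partner`: `t′(γ′)` IS the transport of `t_H(γ_H)`; `e ∘ ι` is injective).  Hence the `H`- and `G′`-junction scalars of one `G`-regular packet coincide.
[cite: Rogawski1990, §1.7 p. 6; §4.3 (4.3.1) p. 43; §14.3 pp. 233–234] [cite: Shelstad1979, §4 p. 20] [cite: LanglandsShelstad1987, §1.3–1.4] -/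
theorem measure_box_partner_eq_of_image_eq {γ' : ↥(arch (↥(maximalRealSubfield L)) L (IsCMField.complexConj L) 3 H')} (hnp : IsArchNormPair L H' γH γ')
    {B : Set (Subgroup.centralizer ({γH} : Set (↥(arch (↥(maximalRealSubfield L)) L (IsCMField.complexConj L) 2 (Matrix.of fun i j : Fin 2 => if i.val + j.val + 1 = 2 then (1 : L) else 0)) × ↥(arch (↥(maximalRealSubfield L)) L (IsCMField.complexConj L) 1 (Matrix.of fun i j : Fin 1 => if i.val + j.val + 1 = 1 then (1 : L) else 0)))))} {B' : Set (Subgroup.centralizer ({γ'} : Set (↥(arch (↥(maximalRealSubfield L)) L (IsCMField.complexConj L) 3 H'))))}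
    (hB' : MeasurableSet B')
    (hBB' : (⇑(UnitaryGroup.archStableCentralizerEquiv L hd₃ hd' (hnp.corresponds_endoEmbArch L H') (hreg.isRegularElt_endoEmbArch L)) ∘ ⇑(endoEmbArchCentralizer L γH)) '' B = B') :
    t' γ' B' = tH γH B := by
  have key := map_archStableCentralizerEquiv_endoEmbArchCentralizer_eq_of_isArchNormPair L H' t' t tH hd' hd₃ hC'G hCH hreg hnp
  have hinj : Function.Injective (⇑(UnitaryGroup.archStableCentralizerEquiv L hd₃ hd' (hnp.corresponds_endoEmbArch L H') (hreg.isRegularElt_endoEmbArch L)) ∘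
      ⇑(endoEmbArchCentralizer L γH)) :=
    (UnitaryGroup.archStableCentralizerEquiv L hd₃ hd' (hnp.corresponds_endoEmbArch L H') (hreg.isRegularElt_endoEmbArch L)).injective.comp
      (endoEmbArchCentralizer_injective L γH)
  have hmeas : Measurable (⇑(UnitaryGroup.archStableCentralizerEquiv L hd₃ hd' (hnp.corresponds_endoEmbArch L H') (hreg.isRegularElt_endoEmbArch L)) ∘
      ⇑(endoEmbArchCentralizer L γH)) :=
    (UnitaryGroup.archStableCentralizerEquiv L hd₃ hd' (hnp.corresponds_endoEmbArch L H') (hreg.isRegularElt_endoEmbArch L)).continuous.measurable.comp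
      (continuous_endoEmbArchCentralizer L γH).measurable
  rw [← key, Measure.map_apply hmeas hB', ← hBB', hinj.preimage_image]

end Packet

end Literature.NumberTheory.Rogawski1990

end
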